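import Summits.BirchSwinnertonDyer.BirchSwinnertonDyer.Theorems.PrintCf2RamifiedOffTYZCasselsTatePin
import Summits.BirchSwinnertonDyer.BirchSwinnertonDyer.Theorems.PrintCf2RamifiedOffTYZCasselsTateAdjugateForm
import Literature.NumberTheory.EllipticCurves.TwoTorsionCardProofs
import HarnessLib

/-!
# The ADJUGATE PIN, general form (crux stmt-BirchSwinnertonDyer-20509 `RamifiedOffTYZOfFacts`, line `offtyz-v7`, LEAD cruxlead-20509
# g22, cycle 23) — pieces (E)×(S) of the idea `cassels-tate-entries` (item 23431) IN COORDINATES, for any elliptic curve over a number field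

HONEST FRAMING (cell `bsd-print-cf2`, route `PrintCf2`; `--supports stmt-BirchSwinnertonDyer-20509`; `def`-free, fact-free, no `sorry`:
the Cassels–Tate form is an explicit ARGUMENT `C` with its (U4) kernel shape `hl`, exactly as in g21's `CasselsTatePin*`). BSD is not
proved by any of this; no class is closed; 20509 / 23431 / 23432 stay OPEN.

WHAT. g21 (`PrintCf2RamifiedOffTYZCasselsTatePin.lean`) proved the PIN: if `Ш(E/K)[4] = Ш(E/K)[2]`, the radical of any pairing `C` on
`Sel₂(E/K)` with left kernel `[2]_* Sel₄(E/K)` is EXACTLY the Kummer image `κ₂(E(K))`. The idea card's Addendum asks for this in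
COORDINATES («`κ₂(R)·κ₂(R)ᵀ ≡ adj(C)`»): fix ANY three Selmer classes `s₁ s₂ s₃` generating `Sel₂(E/K)` over the torsion classes
`κ₂(E(K)[2])` (e.g. a symbol basis), with ENTRIES `c_ij = ⟨sᵢ, sⱼ⟩`, and let `v = [c₂₃ ≠ 0]s₁ + [c₁₃ ≠ 0]s₂ + [c₁₂ ≠ 0]s₃` be the
adjugate (Pfaffian) vector. For `C` alternating with left kernel `[2]_* Sel₄` and values in a group with collinear `2`-torsion (e.g. `ℚ/ℤ`):

* `forall_apply_eq_zero_of_kummer` — Kummer classes are radical; `forall_forall_apply_eq_zero_iff_entries` — `C ≡ 0 ⟺ c₁₂ = c₁₃ = c₂₃ = 0`;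
  `adjugate_apply_eq_zero` — `v` is radical; `even_iff_kummer_eq_torsion_class` — `P ∈ E(K)[2] + 2E(K) ⟺ κ₂(P)` is a torsion class.
* ★ `kummer_eq_or_eq_add_adjugate` — if not all entries vanish and `s₁ s₂ s₃` generate over TORSION classes: **every rational point `P`
  has `κ₂(P) ≡ 0` or `≡ v` modulo a torsion class** (no hypothesis on `Ш`).
* ★ `kummer_ne_adjugate_of_two_torsion` — if moreover `#Sel₂(E/K) > 16`: `v` is NOT a torsion class (`#E(K)[2] ≤ 4`, counting).
* ★ `exists_kummer_eq_adjugate` — if `Ш[4] = Ш[2]`: some rational point has `κ₂(P) = v`; ★★ `exists_odd_point_kummer_eq_adjugate` — with all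
  of the above: **a rational point `P ∉ E(K)[2] + 2E(K)` has `κ₂(P) = v`** — the three entries NAME the `2`-Selmer coordinates of the
  odd part of the Mordell–Weil group.

The companion `…CasselsTateAdjugatePinJumpOne.lean` specialises to the jump-one class of `E_n` (where `Ш[4] = Ш[2]`, `#Sel₂ = 32` and
«not all entries zero» follow from `#Sel₂ = 2⁵`, `#Sel₄ = 2⁶`, rank one: g21). Linear algebra: `…CasselsTateAdjugateForm.lean`.
References: Cassels 1998 (the pairing on `Sel₂/E[2]`); Milne *ADT* I §6; Silverman *AEC* VIII §2, X §4, III §2; the card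
`Cruxes/RamifiedJumpOneLevelTwoOfFacts/Ideas/cassels-tate-entries.md` (Addendum).
-/

noncomputable section

open scoped Classical

open WeierstrassCurve Literature.NumberTheory.EllipticCurves Summit.BirchSwinnertonDyer.PrintCf2.CasselsTatePin

set_option autoImplicit false

universe u

namespace Summit.BirchSwinnertonDyer.PrintCf2.AdjugatePin

/-! ## §1 Any elliptic curve over a number field (fact-free) -/

section General

variable {K : Type u} [Field K] [NumberField K] (W : WeierstrassCurve K) [W.IsElliptic] {T : Type*} [AddCommGroup T]

/-- **Kummer classes are radical**: for any pairing `C` on `Sel₂(E/K)` with left kernel `[2]_* Sel₄(E/K)`, a Selmer class that is the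
Kummer class of a rational point pairs to zero with everything (`π₂ κ₂(P) = 0 ∈ 2·Ш[4]`). [cite: SilvermanAEC2009, Thm. X.4.2(a)]
[cite: MilneADT2006, Ch. I §6 Lemma 6.17] -/
theorem forall_apply_eq_zero_of_kummer (C : selmerGroup W 2 →+ selmerGroup W 2 →+ T)
    (hl : ∀ s, (∀ t, C s t = 0) ↔ s ∈ (selmerZSMul W (d := 2) (n := 4) 2 four_dvd_two_mul_two).range)
    (hdiv : ∀ P : geomPoints W, ∃ Q : geomPoints W, (2 : ℤ) • Q = P) (r : selmerGroup W 2) (P : W.toAffine.Point)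
    (hP : kummerMapTorsion W 2 hdiv P = (r : galH1Torsion W 2)) (u : selmerGroup W 2) : C r u = 0 := by
  refine ((hl r).mpr ?_) u
  rw [mem_range_selmerZSMul_two_iff]
  refine ⟨0, smul_zero _, ?_⟩
  rw [smul_zero, eq_comm]
  exact (selmerToSha_eq_zero_iff_exists_kummer W hdiv r).mpr ⟨P, hP⟩

/-- Generation of `Sel₂(E/K)` by `s₁ s₂ s₃` over Kummer classes gives generation over the radical of any pairing with left kernel
`[2]_* Sel₄` (the hypothesis shape of the linear-algebra file). [cite: SilvermanAEC2009, Thm. X.4.2(a)] -/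
theorem gen_radical_of_gen_kummer (C : selmerGroup W 2 →+ selmerGroup W 2 →+ T)
    (hl : ∀ s, (∀ t, C s t = 0) ↔ s ∈ (selmerZSMul W (d := 2) (n := 4) 2 four_dvd_two_mul_two).range)
    (hdiv : ∀ P : geomPoints W, ∃ Q : geomPoints W, (2 : ℤ) • Q = P) (s₁ s₂ s₃ : selmerGroup W 2)
    (hgen : ∀ t : selmerGroup W 2, ∃ (P : W.toAffine.Point) (b₁ b₂ b₃ : ℤ),
      (t : galH1Torsion W 2) = kummerMapTorsion W 2 hdiv P + ((b₁ • s₁ + b₂ • s₂ + b₃ • s₃ : selmerGroup W 2) : galH1Torsion W 2))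
    (t : selmerGroup W 2) :
    ∃ r : selmerGroup W 2, (∀ u, C r u = 0) ∧ ∃ b₁ b₂ b₃ : ℤ, t = r + b₁ • s₁ + b₂ • s₂ + b₃ • s₃ := by
  obtain ⟨P, b₁, b₂, b₃, ht⟩ := hgen t
  refine ⟨t - (b₁ • s₁ + b₂ • s₂ + b₃ • s₃), forall_apply_eq_zero_of_kummer W C hl hdiv _ P ?_, b₁, b₂, b₃, by abel⟩
  rw [AddSubgroupClass.coe_sub, ht, add_sub_cancel_right]

/-- **`C ≡ 0 ⟺ c₁₂ = c₁₃ = c₂₃ = 0`** for an alternating pairing `C` on `Sel₂(E/K)` with left kernel `[2]_* Sel₄` and three Selmer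
classes generating `Sel₂(E/K)` over Kummer classes. [cite: MilneADT2006, Ch. I §6 Lemma 6.17] [cite: SilvermanAEC2009, Thm. X.4.2(a)] -/
theorem forall_forall_apply_eq_zero_iff_entries (C : selmerGroup W 2 →+ selmerGroup W 2 →+ T) (halt : ∀ s, C s s = 0)
    (hl : ∀ s, (∀ t, C s t = 0) ↔ s ∈ (selmerZSMul W (d := 2) (n := 4) 2 four_dvd_two_mul_two).range)
    (hdiv : ∀ P : geomPoints W, ∃ Q : geomPoints W, (2 : ℤ) • Q = P) (s₁ s₂ s₃ : selmerGroup W 2)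
    (hgen : ∀ t : selmerGroup W 2, ∃ (P : W.toAffine.Point) (b₁ b₂ b₃ : ℤ),
      (t : galH1Torsion W 2) = kummerMapTorsion W 2 hdiv P + ((b₁ • s₁ + b₂ • s₂ + b₃ • s₃ : selmerGroup W 2) : galH1Torsion W 2)) :
    (∀ s t, C s t = 0) ↔ (C s₁ s₂ = 0 ∧ C s₁ s₃ = 0 ∧ C s₂ s₃ = 0) :=
  AdjugateForm.forall_forall_apply_eq_zero_iff_entries C s₁ s₂ s₃ (two_nsmul_selmerGroup_two W) halt
    (gen_radical_of_gen_kummer W C hl hdiv s₁ s₂ s₃ hgen)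

/-- **The adjugate vector is radical**: for an alternating pairing `C` on `Sel₂(E/K)` with left kernel `[2]_* Sel₄`, values in a group
with collinear `2`-torsion (e.g. `ℚ/ℤ`), and generators `s₁ s₂ s₃` over Kummer classes, `v = [c₂₃ ≠ 0]s₁ + [c₁₃ ≠ 0]s₂ + [c₁₂ ≠ 0]s₃`
pairs to zero with every class. [cite: MilneADT2006, Ch. I §6 Lemma 6.17] -/
theorem adjugate_apply_eq_zero (C : selmerGroup W 2 →+ selmerGroup W 2 →+ T) (halt : ∀ s, C s s = 0)
    (hl : ∀ s, (∀ t, C s t = 0) ↔ s ∈ (selmerZSMul W (d := 2) (n := 4) 2 four_dvd_two_mul_two).range)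
    (hT : ∀ x y : T, (2 : ℕ) • x = 0 → (2 : ℕ) • y = 0 → x = 0 ∨ y = 0 ∨ x = y)
    (hdiv : ∀ P : geomPoints W, ∃ Q : geomPoints W, (2 : ℤ) • Q = P) (s₁ s₂ s₃ v : selmerGroup W 2)
    (hv : v = (if C s₂ s₃ = 0 then 0 else s₁) + (if C s₁ s₃ = 0 then 0 else s₂) + (if C s₁ s₂ = 0 then 0 else s₃))
    (hgen : ∀ t : selmerGroup W 2, ∃ (P : W.toAffine.Point) (b₁ b₂ b₃ : ℤ),
      (t : galH1Torsion W 2) = kummerMapTorsion W 2 hdiv P + ((b₁ • s₁ + b₂ • s₂ + b₃ • s₃ : selmerGroup W 2) : galH1Torsion W 2))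
    (t : selmerGroup W 2) : C v t = 0 :=
  AdjugateForm.adjugate_apply_eq_zero C s₁ s₂ s₃ (two_nsmul_selmerGroup_two W) halt hT v hv
    (gen_radical_of_gen_kummer W C hl hdiv s₁ s₂ s₃ hgen) t

omit [W.IsElliptic] in
/-- **Dictionary** (Kummer exactness, fact-free): a rational point lies in `E(K)[2] + 2E(K)` iff its Kummer class is the class of a
rational `2`-torsion point. [cite: SilvermanAEC2009, VIII.§2 (kernel of the Kummer map)] -/
theorem even_iff_kummer_eq_torsion_class
    (hdiv : ∀ P : geomPoints W, ∃ Q : geomPoints W, (2 : ℤ) • Q = P) (P : W.toAffine.Point) :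
    (∃ T Q : W.toAffine.Point, (2 : ℤ) • T = 0 ∧ P = T + (2 : ℤ) • Q) ↔
      ∃ T : W.toAffine.Point, (2 : ℤ) • T = 0 ∧ kummerMapTorsion W 2 hdiv P = kummerMapTorsion W 2 hdiv T := by
  constructor
  · rintro ⟨T, Q, hT, rfl⟩
    refine ⟨T, hT, ?_⟩
    have hQ : kummerMapTorsion W 2 hdiv ((2 : ℤ) • Q) = 0 := by
      rw [← AddMonoidHom.mem_ker, kummerMapTorsion_ker]
      exact ⟨Q, rfl⟩
    rw [map_add, hQ, add_zero]
  · rintro ⟨T, hT, hPT⟩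
    have hker : P - T ∈ (kummerMapTorsion W 2 hdiv).ker := by
      rw [AddMonoidHom.mem_ker, map_sub, hPT, sub_self]
    rw [kummerMapTorsion_ker] at hker
    obtain ⟨Q, hQ⟩ := hker
    exact ⟨T, Q, hT, by rw [← sub_eq_iff_eq_add', ← hQ]; rfl⟩

/-- ★ **ADJUGATE PIN — uniqueness half** (any `E/K`, no Ш-hypothesis): for an alternating `C` on `Sel₂(E/K)` with left kernel
`[2]_* Sel₄`, values with collinear `2`-torsion, NOT all three entries zero, and generators `s₁ s₂ s₃` of `Sel₂(E/K)` over the TORSION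
classes `κ₂(E(K)[2])`: **every rational point `P` has `κ₂(P) = κ₂(T)` or `κ₂(P) = κ₂(T) + v` for some rational `2`-torsion point `T`**
(`v` the adjugate vector) — the `2`-Selmer coordinates of a rational point modulo torsion classes are `0` or `([c₂₃ ≠ 0], [c₁₃ ≠ 0], [c₁₂ ≠ 0])`.
[cite: MilneADT2006, Ch. I §6 Lemma 6.17] [cite: SilvermanAEC2009, Thm. X.4.2(a)] -/
theorem kummer_eq_or_eq_add_adjugate (C : selmerGroup W 2 →+ selmerGroup W 2 →+ T) (halt : ∀ s, C s s = 0)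
    (hl : ∀ s, (∀ t, C s t = 0) ↔ s ∈ (selmerZSMul W (d := 2) (n := 4) 2 four_dvd_two_mul_two).range)
    (hT : ∀ x y : T, (2 : ℕ) • x = 0 → (2 : ℕ) • y = 0 → x = 0 ∨ y = 0 ∨ x = y)
    (hdiv : ∀ P : geomPoints W, ∃ Q : geomPoints W, (2 : ℤ) • Q = P) (s₁ s₂ s₃ v : selmerGroup W 2)
    (hv : v = (if C s₂ s₃ = 0 then 0 else s₁) + (if C s₁ s₃ = 0 then 0 else s₂) + (if C s₁ s₂ = 0 then 0 else s₃))
    (hne : ¬ (C s₁ s₂ = 0 ∧ C s₁ s₃ = 0 ∧ C s₂ s₃ = 0))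
    (hgenK : ∀ t : selmerGroup W 2, ∃ (P : W.toAffine.Point) (b₁ b₂ b₃ : ℤ), (2 : ℤ) • P = 0 ∧
      (t : galH1Torsion W 2) = kummerMapTorsion W 2 hdiv P + ((b₁ • s₁ + b₂ • s₂ + b₃ • s₃ : selmerGroup W 2) : galH1Torsion W 2))
    (P : W.toAffine.Point) :
    ∃ T₀ : W.toAffine.Point, (2 : ℤ) • T₀ = 0 ∧
      (kummerMapTorsion W 2 hdiv P = kummerMapTorsion W 2 hdiv T₀ ∨
        kummerMapTorsion W 2 hdiv P = kummerMapTorsion W 2 hdiv T₀ + (v : galH1Torsion W 2)) := by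
  -- coordinates of `κ₂ P`
  let t : selmerGroup W 2 := ⟨kummerMapTorsion W 2 hdiv P, kummerMapTorsion_mem_selmerGroup W 2 hdiv P⟩
  obtain ⟨T₀, b₁, b₂, b₃, hT₀, ht⟩ := hgenK t
  refine ⟨T₀, hT₀, ?_⟩
  -- the torsion class as a Selmer element; `w = t − r₀ = b₁s₁ + b₂s₂ + b₃s₃` is radical (difference of two Kummer classes)
  let r₀ : selmerGroup W 2 := ⟨kummerMapTorsion W 2 hdiv T₀, kummerMapTorsion_mem_selmerGroup W 2 hdiv T₀⟩
  have hw : b₁ • s₁ + b₂ • s₂ + b₃ • s₃ = t - r₀ :=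
    Subtype.ext (by rw [AddSubgroupClass.coe_sub, eq_sub_iff_add_eq', ← ht])
  have hrad : ∀ u, C (b₁ • s₁ + b₂ • s₂ + b₃ • s₃) u = 0 := fun u => by
    rw [hw, map_sub, AddMonoidHom.sub_apply, forall_apply_eq_zero_of_kummer W C hl hdiv t P rfl u,
      forall_apply_eq_zero_of_kummer W C hl hdiv r₀ T₀ rfl u, sub_zero]
  have hP : kummerMapTorsion W 2 hdiv P = (t : galH1Torsion W 2) := rfl
  rcases AdjugateForm.combination_eq_zero_or_eq_adjugate C s₁ s₂ s₃ (two_nsmul_selmerGroup_two W) halt hT v hv hne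
      b₁ b₂ b₃ hrad with h0 | hv'
  · left
    rw [hP, ht, h0, AddSubgroup.coe_zero, add_zero]
  · right
    rw [hP, ht, hv']

omit [W.IsElliptic] in
/-- ★ **The adjugate vector is NOT a torsion class** (any `E/K` with `#Sel₂(E/K) > 16`, generators over torsion classes, not all
entries zero): if `κ₂(T₀) = v` for a rational `2`-torsion point `T₀`, one generator would be redundant and `#Sel₂ ≤ 4 · #E(K)[2] ≤ 16`.
[cite: SilvermanAEC2009, III.§2 Ex. 3.7, Cor. III.6.4(b) (#E(K)[2] ≤ 4)] [cite: HeathBrown1994SelmerCongruentII, §1] -/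
theorem kummer_ne_adjugate_of_two_torsion (C : selmerGroup W 2 →+ selmerGroup W 2 →+ T)
    (hdiv : ∀ P : geomPoints W, ∃ Q : geomPoints W, (2 : ℤ) • Q = P) (s₁ s₂ s₃ v : selmerGroup W 2)
    (hv : v = (if C s₂ s₃ = 0 then 0 else s₁) + (if C s₁ s₃ = 0 then 0 else s₂) + (if C s₁ s₂ = 0 then 0 else s₃))
    (hne : ¬ (C s₁ s₂ = 0 ∧ C s₁ s₃ = 0 ∧ C s₂ s₃ = 0))
    [Finite (AddSubgroup.torsionBy W.toAffine.Point (2 : ℤ))] (h16 : 16 < Nat.card (selmerGroup W 2))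
    (hgenK : ∀ t : selmerGroup W 2, ∃ (P : W.toAffine.Point) (b₁ b₂ b₃ : ℤ), (2 : ℤ) • P = 0 ∧
      (t : galH1Torsion W 2) = kummerMapTorsion W 2 hdiv P + ((b₁ • s₁ + b₂ • s₂ + b₃ • s₃ : selmerGroup W 2) : galH1Torsion W 2))
    (T₀ : W.toAffine.Point) (hT₀ : (2 : ℤ) • T₀ = 0) :
    kummerMapTorsion W 2 hdiv T₀ ≠ (v : galH1Torsion W 2) := by
  intro hTv
  -- the torsion classes: `κ₂` restricted to `A = E(K)[2]`, landing in `Sel₂(E/K)`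
  set A : AddSubgroup W.toAffine.Point := AddSubgroup.torsionBy W.toAffine.Point (2 : ℤ) with hA
  have hcardA : Nat.card A ≤ 4 := W.natCard_torsionBy_two_le two_ne_zero
  let κ : A →+ selmerGroup W 2 :=
    ((kummerMapTorsion W 2 hdiv).comp A.subtype).codRestrict (selmerGroup W 2)
      (fun T => kummerMapTorsion_mem_selmerGroup W 2 hdiv (T : W.toAffine.Point))
  have hκ : ∀ T : A, ((κ T : selmerGroup W 2) : galH1Torsion W 2) = kummerMapTorsion W 2 hdiv (T : W.toAffine.Point) :=
    fun T => rfl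
  -- generation by `κ(A)` and `s₁ s₂ s₃` inside `Sel₂(E/K)`
  have hgenA : ∀ t : selmerGroup W 2, ∃ a : A, ∃ b₁ b₂ b₃ : ℤ, t = κ a + b₁ • s₁ + b₂ • s₂ + b₃ • s₃ := by
    intro t
    obtain ⟨P, b₁, b₂, b₃, hP, ht⟩ := hgenK t
    refine ⟨⟨P, (Submodule.mem_torsionBy_iff (R := ℤ) _ _).mpr hP⟩, b₁, b₂, b₃, Subtype.ext ?_⟩
    rw [ht]
    simp only [AddSubgroup.coe_add, hκ]
    abel
  have h2s : ∀ s : selmerGroup W 2, (2 : ℕ) • s = 0 := two_nsmul_selmerGroup_two W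
  -- `T₀` as an element of `A`, with `κ T₀' = v`
  let T₀' : A := ⟨T₀, (Submodule.mem_torsionBy_iff (R := ℤ) _ _).mpr hT₀⟩
  have hκT₀ : κ T₀' = v := Subtype.ext (by rw [hκ]; exact hTv)
  -- `(if p then 0 else s) = e • s` with `e ∈ {0, 1}`
  have hite : ∀ (p : Prop) [Decidable p] (s : selmerGroup W 2),
      (if p then (0 : selmerGroup W 2) else s) = (if p then (0 : ℤ) else 1) • s := by
    intro p _ s
    split_ifs <;> simp
  -- in each case one generator is redundant ⇒ `#Sel₂ ≤ 4·#A`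
  have hle : Nat.card (selmerGroup W 2) ≤ Nat.card A * 4 := by
    by_cases h₁₂ : C s₁ s₂ = 0
    · by_cases h₁₃ : C s₁ s₃ = 0
      · -- only `c₂₃ ≠ 0`: `v = s₁ = κ T₀'` is redundant; generators reordered `(s₂, s₃, s₁)`
        have h₂₃ : ¬ C s₂ s₃ = 0 := fun h => hne ⟨h₁₂, h₁₃, h⟩
        rw [h₁₂, h₁₃, if_neg h₂₃, if_pos rfl, if_pos rfl, add_zero, add_zero] at hv
        refine AdjugateForm.natCard_le_of_redundant κ s₂ s₃ s₁ (h2s _) (h2s _) (fun t => ?_) T₀' 0 0 ?_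
        · obtain ⟨a, b₁, b₂, b₃, rfl⟩ := hgenA t
          exact ⟨a, b₂, b₃, b₁, by abel⟩
        · rw [hκT₀, hv, zero_smul, zero_smul, add_zero, add_zero]
      · -- `c₁₃ ≠ 0`, `c₁₂ = 0`: `v = [c₂₃ ≠ 0]s₁ + s₂`, so `s₂` is redundant; generators reordered `(s₁, s₃, s₂)`
        rw [h₁₂, if_neg h₁₃, if_pos rfl, add_zero, hite] at hv
        refine AdjugateForm.natCard_le_of_redundant κ s₁ s₃ s₂ (h2s _) (h2s _) (fun t => ?_) T₀'
          (-(if C s₂ s₃ = 0 then (0 : ℤ) else 1)) 0 ?_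
        · obtain ⟨a, b₁, b₂, b₃, rfl⟩ := hgenA t
          exact ⟨a, b₁, b₃, b₂, by abel⟩
        · rw [hκT₀, hv, neg_smul, zero_smul, add_zero]
          abel
    · -- `c₁₂ ≠ 0`: `v = [c₂₃ ≠ 0]s₁ + [c₁₃ ≠ 0]s₂ + s₃`, so `s₃` is redundant
      rw [if_neg h₁₂, hite, hite] at hv
      refine AdjugateForm.natCard_le_of_redundant κ s₁ s₂ s₃ (h2s _) (h2s _) hgenA T₀'
        (-(if C s₂ s₃ = 0 then (0 : ℤ) else 1)) (-(if C s₁ s₃ = 0 then (0 : ℤ) else 1)) ?_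
      rw [hκT₀, hv, neg_smul, neg_smul]
      abel
  omega

/-- ★ **ADJUGATE PIN — existence half** (any `E/K` with `Ш(E/K)[4] = Ш(E/K)[2]`): for an alternating `C` on `Sel₂(E/K)` with left
kernel `[2]_* Sel₄`, values with collinear `2`-torsion, and generators `s₁ s₂ s₃` over Kummer classes, **some rational point `P` has
`κ₂(P) = v`** (the radical is the Kummer image by g21's PIN, and `v` is radical). [cite: MilneADT2006, Ch. I §6 Thm. 6.13(a), Lemma 6.17]
[cite: MorganSmith2021CTP, Thm. 1.3 with Ex. 1.4] [cite: SilvermanAEC2009, Thm. X.4.2(a)] -/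
theorem exists_kummer_eq_adjugate (C : selmerGroup W 2 →+ selmerGroup W 2 →+ T) (halt : ∀ s, C s s = 0)
    (hl : ∀ s, (∀ t, C s t = 0) ↔ s ∈ (selmerZSMul W (d := 2) (n := 4) 2 four_dvd_two_mul_two).range)
    (hT : ∀ x y : T, (2 : ℕ) • x = 0 → (2 : ℕ) • y = 0 → x = 0 ∨ y = 0 ∨ x = y)
    (hexp : ∀ w : W.sha, (4 : ℤ) • w = 0 → (2 : ℤ) • w = 0)
    (hdiv : ∀ P : geomPoints W, ∃ Q : geomPoints W, (2 : ℤ) • Q = P) (s₁ s₂ s₃ v : selmerGroup W 2)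
    (hv : v = (if C s₂ s₃ = 0 then 0 else s₁) + (if C s₁ s₃ = 0 then 0 else s₂) + (if C s₁ s₂ = 0 then 0 else s₃))
    (hgen : ∀ t : selmerGroup W 2, ∃ (P : W.toAffine.Point) (b₁ b₂ b₃ : ℤ),
      (t : galH1Torsion W 2) = kummerMapTorsion W 2 hdiv P + ((b₁ • s₁ + b₂ • s₂ + b₃ • s₃ : selmerGroup W 2) : galH1Torsion W 2)) :
    ∃ P : W.toAffine.Point, kummerMapTorsion W 2 hdiv P = (v : galH1Torsion W 2) :=
  (forall_apply_eq_zero_iff_exists_kummer W C hl hexp hdiv v).mp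
    (adjugate_apply_eq_zero W C halt hl hT hdiv s₁ s₂ s₃ v hv hgen)

/-- ★★ **THE ADJUGATE PIN NAMES AN ODD POINT** (any `E/K` with `Ш[4] = Ш[2]`, `#Sel₂ > 16`, finite `E(K)[2]`): for an alternating `C`
on `Sel₂(E/K)` with left kernel `[2]_* Sel₄` (values with collinear `2`-torsion, not all entries zero) and generators `s₁ s₂ s₃` over the
torsion classes: **there is a rational point `P ∉ E(K)[2] + 2E(K)` with `κ₂(P) = [c₂₃ ≠ 0]s₁ + [c₁₃ ≠ 0]s₂ + [c₁₂ ≠ 0]s₃`.**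
[cite: MilneADT2006, Ch. I §6 Thm. 6.13(a), Lemma 6.17] [cite: SilvermanAEC2009, Thm. X.4.2(a), VIII.§2] -/
theorem exists_odd_point_kummer_eq_adjugate (C : selmerGroup W 2 →+ selmerGroup W 2 →+ T) (halt : ∀ s, C s s = 0)
    (hl : ∀ s, (∀ t, C s t = 0) ↔ s ∈ (selmerZSMul W (d := 2) (n := 4) 2 four_dvd_two_mul_two).range)
    (hT : ∀ x y : T, (2 : ℕ) • x = 0 → (2 : ℕ) • y = 0 → x = 0 ∨ y = 0 ∨ x = y)
    (hexp : ∀ w : W.sha, (4 : ℤ) • w = 0 → (2 : ℤ) • w = 0)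
    (hdiv : ∀ P : geomPoints W, ∃ Q : geomPoints W, (2 : ℤ) • Q = P) (s₁ s₂ s₃ v : selmerGroup W 2)
    (hv : v = (if C s₂ s₃ = 0 then 0 else s₁) + (if C s₁ s₃ = 0 then 0 else s₂) + (if C s₁ s₂ = 0 then 0 else s₃))
    (hne : ¬ (C s₁ s₂ = 0 ∧ C s₁ s₃ = 0 ∧ C s₂ s₃ = 0))
    [Finite (AddSubgroup.torsionBy W.toAffine.Point (2 : ℤ))] (h16 : 16 < Nat.card (selmerGroup W 2))
    (hgenK : ∀ t : selmerGroup W 2, ∃ (P : W.toAffine.Point) (b₁ b₂ b₃ : ℤ), (2 : ℤ) • P = 0 ∧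
      (t : galH1Torsion W 2) = kummerMapTorsion W 2 hdiv P + ((b₁ • s₁ + b₂ • s₂ + b₃ • s₃ : selmerGroup W 2) : galH1Torsion W 2)) :
    ∃ P : W.toAffine.Point, kummerMapTorsion W 2 hdiv P = (v : galH1Torsion W 2) ∧
      ∀ T₀ Q : W.toAffine.Point, (2 : ℤ) • T₀ = 0 → P ≠ T₀ + (2 : ℤ) • Q := by
  have hgen : ∀ t : selmerGroup W 2, ∃ (P : W.toAffine.Point) (b₁ b₂ b₃ : ℤ),
      (t : galH1Torsion W 2) = kummerMapTorsion W 2 hdiv P + ((b₁ • s₁ + b₂ • s₂ + b₃ • s₃ : selmerGroup W 2) : galH1Torsion W 2) :=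
    fun t => by obtain ⟨P, b₁, b₂, b₃, -, h⟩ := hgenK t; exact ⟨P, b₁, b₂, b₃, h⟩
  obtain ⟨P, hP⟩ := exists_kummer_eq_adjugate W C halt hl hT hexp hdiv s₁ s₂ s₃ v hv hgen
  refine ⟨P, hP, fun T₀ Q hT₀ hPQ => ?_⟩
  obtain ⟨T, hT2, hPT⟩ := (even_iff_kummer_eq_torsion_class W hdiv P).mp ⟨T₀, Q, hT₀, hPQ⟩
  exact kummer_ne_adjugate_of_two_torsion W C hdiv s₁ s₂ s₃ v hv hne h16 hgenK T hT2 (hPT ▸ hP)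


omit [W.IsElliptic] in
/-- In a group killed by `2`, the difference of two conditional (`bif`) copies of `s` is the conditional copy on the XOR. [folklore] -/
theorem cond_sub_cond_eq_cond_bne (s : selmerGroup W 2) (a b : Bool) :
    ((bif a then s else 0) - (bif b then s else 0) : selmerGroup W 2) = bif (a != b) then s else 0 := by
  have h2 : s + s = 0 := by rw [← two_nsmul]; exact two_nsmul_selmerGroup_two W s
  have hneg : -s = s := by rw [neg_eq_iff_add_eq_zero, h2]
  cases a <;> cases b <;> simp [hneg]

omit [W.IsElliptic] in
/-- **INDEPENDENCE ⟹ GENERATION over torsion classes** (how a consumer discharges the hypothesis `hgenK` of the adjugate pin from finitely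
many NON-membership checks): if `#Sel₂(E/K) = 8 · #E(K)[2]`, the Kummer map is injective on `E(K)[2]` (no rational `2`-torsion point is
divisible by `2`), and no non-trivial `{0,1}`-combination of `s₁ s₂ s₃` is a torsion class, then every `2`-Selmer class is a torsion class
plus an integer combination of `s₁ s₂ s₃` (an injection between finite sets of equal size is onto). [cite: SilvermanAEC2009, Thm. X.4.2(a)]
[cite: HeathBrown1994SelmerCongruentII, §1] -/
theorem genTorsion_of_independent (hdiv : ∀ P : geomPoints W, ∃ Q : geomPoints W, (2 : ℤ) • Q = P) (s₁ s₂ s₃ : selmerGroup W 2)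
    [Finite (AddSubgroup.torsionBy W.toAffine.Point (2 : ℤ))]
    (hcard : Nat.card (selmerGroup W 2) = Nat.card (AddSubgroup.torsionBy W.toAffine.Point (2 : ℤ)) * 8)
    (hinjK : ∀ T : W.toAffine.Point, (2 : ℤ) • T = 0 → kummerMapTorsion W 2 hdiv T = 0 → T = 0)
    (hind : ∀ (T : W.toAffine.Point) (ε₁ ε₂ ε₃ : Bool), (2 : ℤ) • T = 0 →
      kummerMapTorsion W 2 hdiv T =
        (((bif ε₁ then s₁ else 0) + (bif ε₂ then s₂ else 0) + (bif ε₃ then s₃ else 0) : selmerGroup W 2) : galH1Torsion W 2) →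
      ε₁ = false ∧ ε₂ = false ∧ ε₃ = false)
    (t : selmerGroup W 2) :
    ∃ (P : W.toAffine.Point) (b₁ b₂ b₃ : ℤ), (2 : ℤ) • P = 0 ∧
      (t : galH1Torsion W 2) = kummerMapTorsion W 2 hdiv P + ((b₁ • s₁ + b₂ • s₂ + b₃ • s₃ : selmerGroup W 2) : galH1Torsion W 2) := by
  set A : AddSubgroup W.toAffine.Point := AddSubgroup.torsionBy W.toAffine.Point (2 : ℤ) with hA
  have hmemA : ∀ T : A, (2 : ℤ) • (T : W.toAffine.Point) = 0 := fun T =>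
    (Submodule.mem_torsionBy_iff (R := ℤ) _ _).mp T.2
  -- `κ` on `A`, into `Sel₂`
  let κ : A → selmerGroup W 2 := fun T =>
    ⟨kummerMapTorsion W 2 hdiv (T : W.toAffine.Point), kummerMapTorsion_mem_selmerGroup W 2 hdiv _⟩
  have hκ : ∀ T : A, ((κ T : selmerGroup W 2) : galH1Torsion W 2) = kummerMapTorsion W 2 hdiv (T : W.toAffine.Point) :=
    fun T => rfl
  let φ : A × Bool × Bool × Bool → selmerGroup W 2 := fun x =>
    κ x.1 + ((bif x.2.1 then s₁ else 0) + (bif x.2.2.1 then s₂ else 0) + (bif x.2.2.2 then s₃ else 0))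
  -- injectivity from independence
  have hinj : Function.Injective φ := by
    rintro ⟨T, ε₁, ε₂, ε₃⟩ ⟨T', ε₁', ε₂', ε₃'⟩ h
    have h' : κ T + ((bif ε₁ then s₁ else 0) + (bif ε₂ then s₂ else 0) + (bif ε₃ then s₃ else 0)) =
        κ T' + ((bif ε₁' then s₁ else 0) + (bif ε₂' then s₂ else 0) + (bif ε₃' then s₃ else 0)) := h
    -- `κ (T − T') = Σ [εᵢ ≠ ε'ᵢ] sᵢ`
    have hdiff : κ T - κ T' = (bif (ε₁' != ε₁) then s₁ else 0) + (bif (ε₂' != ε₂) then s₂ else 0) +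
        (bif (ε₃' != ε₃) then s₃ else 0) := by
      rw [← cond_sub_cond_eq_cond_bne W s₁, ← cond_sub_cond_eq_cond_bne W s₂, ← cond_sub_cond_eq_cond_bne W s₃]
      calc κ T - κ T'
          = κ T + ((bif ε₁ then s₁ else 0) + (bif ε₂ then s₂ else 0) + (bif ε₃ then s₃ else 0)) -
              ((bif ε₁ then s₁ else 0) + (bif ε₂ then s₂ else 0) + (bif ε₃ then s₃ else 0)) - κ T' := by abel
        _ = κ T' + ((bif ε₁' then s₁ else 0) + (bif ε₂' then s₂ else 0) + (bif ε₃' then s₃ else 0)) -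
              ((bif ε₁ then s₁ else 0) + (bif ε₂ then s₂ else 0) + (bif ε₃ then s₃ else 0)) - κ T' := by rw [h']
        _ = _ := by abel
    have h2TT' : (2 : ℤ) • ((T : W.toAffine.Point) - T') = 0 := by
      rw [smul_sub, hmemA T, hmemA T', sub_zero]
    have hκdiff : kummerMapTorsion W 2 hdiv ((T : W.toAffine.Point) - T') =
        (((bif (ε₁' != ε₁) then s₁ else 0) + (bif (ε₂' != ε₂) then s₂ else 0) + (bif (ε₃' != ε₃) then s₃ else 0) :
          selmerGroup W 2) : galH1Torsion W 2) := by
      rw [map_sub, ← hκ, ← hκ, ← AddSubgroupClass.coe_sub, hdiff]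
    obtain ⟨e₁, e₂, e₃⟩ := hind _ _ _ _ h2TT' hκdiff
    have hε₁ : ε₁' = ε₁ := by revert e₁; cases ε₁ <;> cases ε₁' <;> decide
    have hε₂ : ε₂' = ε₂ := by revert e₂; cases ε₂ <;> cases ε₂' <;> decide
    have hε₃ : ε₃' = ε₃ := by revert e₃; cases ε₃ <;> cases ε₃' <;> decide
    subst hε₁ hε₂ hε₃
    rw [bne_self_eq_false, bne_self_eq_false, bne_self_eq_false, cond_false, cond_false, cond_false, add_zero, add_zero,
      AddSubgroup.coe_zero] at hκdiff
    have hTT' : (T : W.toAffine.Point) - T' = 0 := hinjK _ h2TT' hκdiff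
    rw [sub_eq_zero] at hTT'
    rw [Subtype.ext hTT']
  -- bijectivity by counting
  have hbij : Function.Bijective φ := by
    haveI : Finite (selmerGroup W 2) := Nat.finite_of_card_ne_zero (by
      rw [hcard]
      exact Nat.mul_ne_zero (Nat.card_pos (α := A)).ne' (by norm_num))
    refine (Nat.bijective_iff_injective_and_card φ).mpr ⟨hinj, ?_⟩
    rw [Nat.card_prod, Nat.card_prod, Nat.card_prod, Nat.card_eq_fintype_card (α := Bool), Fintype.card_bool, hcard]
  obtain ⟨⟨T, ε₁, ε₂, ε₃⟩, hx⟩ := hbij.2 t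
  refine ⟨T, (if ε₁ then 1 else 0), (if ε₂ then 1 else 0), (if ε₃ then 1 else 0), hmemA T, ?_⟩
  rw [← hx]
  simp only [φ, AddSubgroup.coe_add, hκ]
  congr 1
  cases ε₁ <;> cases ε₂ <;> cases ε₃ <;> simp

end General

end Summit.BirchSwinnertonDyer.PrintCf2.AdjugatePin

end
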